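import Literature.ModelTheory.ExponentialFields.OrderedExpFieldModels
import Literature.ModelTheory.ExponentialFields.ExistentialReduction
import HarnessLib

/-!
# Existential sentences reduce to exponential-polynomial equations, uniformly in the models of `OEF`

Family `periods` (periods.S27), topic `Literature/ModelTheory/ExponentialFields`: node (B5) of the
decomposition of the conditional half of Macintyre–Wilkie's theorem
(`Literature.ModelTheory.ExponentialFields.macintyreWilkie_existential_of_schanuelProperty`; see
`MacintyreWilkieREAxioms.lean`, `OrderedExpFieldModels.lean`).

Macintyre–Wilkie decide existential sentences of `ℝ_exp` by first bringing them to the form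
`∃x̄ g(x̄) = 0` with `g` an exponential polynomial over `ℤ` (Jones–Servi 2011, transposing
[MW96], **Lemma 3.3**: "Every existential sentence is `K`-equivalent to a sentence of the form
`∃x̄ g(x̄) = 0`, for some `n ∈ ℕ` and `g ∈ M_n(ℤ[α])`", `K` ranging over the models of their weak
theory `T`).  `ExistentialReduction.lean` proves this reduction uniformly in the models of the
*complete* theory `T_exp` (for Wilkie's theorem); the decision procedure needs it uniformly in
the models of the weak *recursive* theory.  This file re-runs the (purely algebraic) argument for
the models of the finite theory `OEF` (`OrderedExpFieldModels.lean`: ordered fields in which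
non-negative elements are squares, with `exp (x+y) = exp x exp y`, `x + 1 ≤ exp x`), reusing the
syntactic constructions `RealExpModel.flat/expArgs/cstr/sqAgg/master` of `ExistentialReduction.lean`:

* `OEFModel.IsExpTermDefinable` and its closure properties, `OEFModel.IsExpTermDefinable.of_isQF`
  (Part 1: quantifier-free conditions are projections of term equations, uniformly in the models
  of `OEF`: `=` by subtraction, `≠` by inverses, `≤` by squares, `<` by `(s₁ - s₂)w² = 1`, `∨` by
  products, `∧` by sums of squares);
* `OEFModel.exists_expPoly_iff` (Part 2: term equations are projections of exponential-polynomial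
  equations `p(ā; x̄, e^{x̄}) = 0`, `p` a term of the language of ordered rings);
* `OEFModel.exists_expPoly_iff_of_isQF`, `OEFModel.exists_expPoly_iff_of_isExistential` and
  `OEFModel.realize_iff_expPoly_of_isExistential`: **for every existential sentence `φ` there are
  `N` and a term `p` of `Language.orderedRing` in `2N` variables such that in every model `K` of
  `OEF`, `K ⊨ φ ↔ ∃ x̄ ∈ K^N, p(x̄, e^{x̄}) = 0`** — Jones–Servi's Lemma 3.3 for `exp` and `OEF`
  (so for every `T ⊇ OEF`, via `Theory.ModelType.toOEFModel`, and for `ℝ_exp` itself).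

Everything here is proved.

## References

* G. O. Jones, T. Servi, *On the decidability of the real field with a generic power function*,
  J. Symb. Log. 76 (2011), Lemma 3.3.
* A. Macintyre, A. J. Wilkie, *On the decidability of the real exponential field*, in:
  Kreiseliana, A K Peters (1996), 441–467.
* A. J. Wilkie, *Model theory of analytic and smooth functions*, in: Models and Computability,
  LMS Lecture Note Ser. 259 (1999), p. 414.
-/

noncomputable section

open FirstOrder FirstOrder.Language FirstOrder.Language.Structure

universe w

namespace Literature.ModelTheory.ExponentialFields

namespace OEFModel

/-! ## Part 1: quantifier-free conditions are projections of term equations (models of `OEF`) -/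

section Definable

variable {δ : Type}

/-- A family of conditions `S K ū` on `δ`-tuples `ū` of the models `K` of `OEF` is *exp-term
definable* if ONE term `t(ū, w̄)` of `Language.orderedExpRing` satisfies
`S K ū ↔ ∃ w̄, t(ū, w̄) = 0` in every model `K` of `OEF` (the `OEF`-uniform version of
`RealExpModel.IsExpTermDefinable`). [folklore] -/
def IsExpTermDefinable
    (S : ∀ K : Language.Theory.ModelType.{0, 0, w} Theory.OEF, (δ → K) → Prop) : Prop :=
  ∃ (m : ℕ) (t : Language.orderedExpRing.Term (δ ⊕ Fin m)),
    ∀ (K : Language.Theory.ModelType.{0, 0, w} Theory.OEF) (u : δ → K),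
      S K u ↔ ∃ w : Fin m → K, t.realize (Sum.elim u w) = 0

namespace IsExpTermDefinable

variable {S S' : ∀ K : Language.Theory.ModelType.{0, 0, w} Theory.OEF, (δ → K) → Prop}

/-- Invariance under equivalence of conditions. [folklore] -/
theorem congr (h : IsExpTermDefinable S) (hSS' : ∀ K u, S K u ↔ S' K u) :
    IsExpTermDefinable S' := by
  obtain ⟨m, t, ht⟩ := h
  exact ⟨m, t, fun K u => (hSS' K u).symm.trans (ht K u)⟩

/-- A term equation `s(ū) = 0` is exp-term definable. [folklore] -/
theorem of_term (s : Language.orderedExpRing.Term δ) :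
    IsExpTermDefinable (fun (K : Language.Theory.ModelType.{0, 0, w} Theory.OEF) (u : δ → K) =>
      s.realize u = 0) := by
  refine ⟨0, s.relabel Sum.inl, fun K u => ?_⟩
  simp only [Term.realize_relabel, Sum.elim_comp_inl]
  exact ⟨fun h => ⟨default, h⟩, fun ⟨_, h⟩ => h⟩

/-- `False` is exp-term definable (`1 = 0`). [folklore] -/
theorem of_false :
    IsExpTermDefinable (fun (K : Language.Theory.ModelType.{0, 0, w} Theory.OEF) (_ : δ → K) =>
      False) := by
  refine ⟨0, 1, fun K u => ?_⟩
  simp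

/-- `True` is exp-term definable (`0 = 0`). [folklore] -/
theorem of_true :
    IsExpTermDefinable (fun (K : Language.Theory.ModelType.{0, 0, w} Theory.OEF) (_ : δ → K) =>
      True) := by
  refine ⟨0, 0, fun K u => ?_⟩
  simp only [realize_zero, exists_const]

/-- Disjunctions: product of the two terms. [folklore] -/
theorem or (h₁ : IsExpTermDefinable S) (h₂ : IsExpTermDefinable S') :
    IsExpTermDefinable (fun K u => S K u ∨ S' K u) := by
  obtain ⟨m₁, t₁, ht₁⟩ := h₁
  obtain ⟨m₂, t₂, ht₂⟩ := h₂
  refine ⟨m₁ + m₂, t₁.relabel (Sum.map _root_.id (Fin.castAdd m₂)) *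
    t₂.relabel (Sum.map _root_.id (Fin.natAdd m₁)), fun K u => ?_⟩
  show S K u ∨ S' K u ↔ _
  rw [ht₁ K u, ht₂ K u]
  simp only [realize_mul, Term.realize_relabel, Sum.elim_comp_map, Function.comp_id, mul_eq_zero]
  constructor
  · rintro (⟨w, hw⟩ | ⟨w, hw⟩)
    · refine ⟨Fin.append w fun _ => 0, Or.inl ?_⟩
      have e : (Fin.append w fun _ => (0 : K)) ∘ Fin.castAdd m₂ = w := funext fun i => by simp
      rw [e]; exact hw
    · refine ⟨Fin.append (fun _ => 0) w, Or.inr ?_⟩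
      have e : (Fin.append (fun _ => (0 : K)) w) ∘ Fin.natAdd m₁ = w := funext fun i => by simp
      rw [e]; exact hw
  · rintro ⟨w, hw | hw⟩
    · exact Or.inl ⟨w ∘ Fin.castAdd m₂, hw⟩
    · exact Or.inr ⟨w ∘ Fin.natAdd m₁, hw⟩

/-- Conjunctions: sum of the squares of the two terms (ordered field). [folklore] -/
theorem and (h₁ : IsExpTermDefinable S) (h₂ : IsExpTermDefinable S') :
    IsExpTermDefinable (fun K u => S K u ∧ S' K u) := by
  obtain ⟨m₁, t₁, ht₁⟩ := h₁
  obtain ⟨m₂, t₂, ht₂⟩ := h₂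
  refine ⟨m₁ + m₂,
    t₁.relabel (Sum.map _root_.id (Fin.castAdd m₂)) * t₁.relabel (Sum.map _root_.id (Fin.castAdd m₂)) +
    t₂.relabel (Sum.map _root_.id (Fin.natAdd m₁)) * t₂.relabel (Sum.map _root_.id (Fin.natAdd m₁)),
    fun K u => ?_⟩
  show S K u ∧ S' K u ↔ _
  rw [ht₁ K u, ht₂ K u]
  simp only [realize_add, realize_mul, Term.realize_relabel, Sum.elim_comp_map, Function.comp_id,
    mul_self_add_mul_self_eq_zero]
  constructor
  · rintro ⟨⟨w₁, hw₁⟩, ⟨w₂, hw₂⟩⟩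
    refine ⟨Fin.append w₁ w₂, ?_, ?_⟩
    · have e : (Fin.append w₁ w₂) ∘ Fin.castAdd m₂ = w₁ := funext fun i => by simp
      rw [e]; exact hw₁
    · have e : (Fin.append w₁ w₂) ∘ Fin.natAdd m₁ = w₂ := funext fun i => by simp
      rw [e]; exact hw₂
  · rintro ⟨w, hw₁, hw₂⟩
    exact ⟨⟨w ∘ Fin.castAdd m₂, hw₁⟩, ⟨w ∘ Fin.natAdd m₁, hw₂⟩⟩

/-- Equations `s₁(ū) = s₂(ū)` (`s₁ - s₂ = 0`). [folklore] -/
theorem eq (s₁ s₂ : Language.orderedExpRing.Term δ) :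
    IsExpTermDefinable (fun (K : Language.Theory.ModelType.{0, 0, w} Theory.OEF) (u : δ → K) =>
      s₁.realize u = s₂.realize u) :=
  (of_term (s₁ + -s₂)).congr fun K u => by
    simp only [realize_add, realize_neg, ← sub_eq_add_neg, sub_eq_zero]

/-- Inequations `s₁(ū) ≠ s₂(ū)` (`∃ w, (s₁ - s₂) w - 1 = 0`, field). [folklore] -/
theorem ne (s₁ s₂ : Language.orderedExpRing.Term δ) :
    IsExpTermDefinable (fun (K : Language.Theory.ModelType.{0, 0, w} Theory.OEF) (u : δ → K) =>
      s₁.realize u ≠ s₂.realize u) := by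
  refine ⟨1, (s₁.relabel Sum.inl + -s₂.relabel Sum.inl) * var (Sum.inr 0) + -1, fun K u => ?_⟩
  simp only [realize_add, realize_mul, realize_neg, realize_one, Term.realize_relabel,
    Term.realize_var, Sum.elim_comp_inl, Sum.elim_inr, ← sub_eq_add_neg, sub_eq_zero]
  constructor
  · intro hne
    exact ⟨fun _ => (s₁.realize u - s₂.realize u)⁻¹, mul_inv_cancel₀ (sub_ne_zero.2 hne)⟩
  · rintro ⟨c, hc⟩ heq
    rw [heq, sub_self, zero_mul] at hc
    exact zero_ne_one hc

/-- Inequalities `s₁(ū) ≤ s₂(ū)` (`∃ w, s₂ - s₁ - w² = 0`: squares axiom of `OEF`). [folklore] -/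
theorem le (s₁ s₂ : Language.orderedExpRing.Term δ) :
    IsExpTermDefinable (fun (K : Language.Theory.ModelType.{0, 0, w} Theory.OEF) (u : δ → K) =>
      s₁.realize u ≤ s₂.realize u) := by
  refine ⟨1, (s₂.relabel Sum.inl + -s₁.relabel Sum.inl) + -(var (Sum.inr 0) * var (Sum.inr 0)),
    fun K u => ?_⟩
  simp only [realize_add, realize_mul, realize_neg, Term.realize_relabel, Term.realize_var,
    Sum.elim_comp_inl, Sum.elim_inr, ← sub_eq_add_neg, sub_eq_zero, le_iff_exists_mul_self]
  exact ⟨fun ⟨c, hc⟩ => ⟨fun _ => c, hc⟩, fun ⟨w, hw⟩ => ⟨w 0, hw⟩⟩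

/-- Strict inequalities `¬ s₁(ū) ≤ s₂(ū)` (`∃ w, (s₁ - s₂) w² - 1 = 0`). [folklore] -/
theorem not_le (s₁ s₂ : Language.orderedExpRing.Term δ) :
    IsExpTermDefinable (fun (K : Language.Theory.ModelType.{0, 0, w} Theory.OEF) (u : δ → K) =>
      ¬ s₁.realize u ≤ s₂.realize u) := by
  refine ⟨1, (s₁.relabel Sum.inl + -s₂.relabel Sum.inl) * (var (Sum.inr 0) * var (Sum.inr 0)) + -1,
    fun K u => ?_⟩
  show ¬ s₁.realize u ≤ s₂.realize u ↔ _
  rw [_root_.not_le, lt_iff_exists_mul_self]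
  simp only [realize_add, realize_mul, realize_neg, realize_one, Term.realize_relabel,
    Term.realize_var, Sum.elim_comp_inl, Sum.elim_inr, ← sub_eq_add_neg, sub_eq_zero]
  exact ⟨fun ⟨c, hc⟩ => ⟨fun _ => c, hc⟩, fun ⟨w, hw⟩ => ⟨w 0, hw⟩⟩

/-- **Normal form of quantifier-free conditions, uniformly in the models of `OEF`**: every
quantifier-free formula `χ` of `Language.orderedExpRing` and its negation are projections of term
equations, `χ(ū) ↔ ∃ w̄, t(ū, w̄) = 0`, the same `t` serving in all models of `OEF`. [folklore] -/
theorem of_isQF {γ : Type} {n : ℕ} {χ : Language.orderedExpRing.BoundedFormula γ n}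
    (hχ : χ.IsQF) :
    IsExpTermDefinable (fun (K : Language.Theory.ModelType.{0, 0, w} Theory.OEF)
        (u : γ ⊕ Fin n → K) => χ.Realize (u ∘ Sum.inl) (u ∘ Sum.inr)) ∧
      IsExpTermDefinable (fun (K : Language.Theory.ModelType.{0, 0, w} Theory.OEF)
        (u : γ ⊕ Fin n → K) => ¬ χ.Realize (u ∘ Sum.inl) (u ∘ Sum.inr)) := by
  induction hχ with
  | falsum =>
    exact ⟨of_false.congr fun K u => by simp [BoundedFormula.Realize],
      of_true.congr fun K u => by simp [BoundedFormula.Realize]⟩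
  | of_isAtomic h =>
    cases h with
    | equal t₁ t₂ =>
      exact ⟨(eq t₁ t₂).congr fun K u => by simp, (ne t₁ t₂).congr fun K u => by simp⟩
    | rel R ts =>
      cases R
      refine ⟨(le (ts 0) (ts 1)).congr fun K u => ?_, (not_le (ts 0) (ts 1)).congr fun K u => ?_⟩
      · simp only [BoundedFormula.realize_rel, Sum.elim_comp_inl_inr, relMap_le]
      · simp only [BoundedFormula.realize_rel, Sum.elim_comp_inl_inr, relMap_le]
  | imp _ _ ih₁ ih₂ =>
    obtain ⟨p₁, n₁⟩ := ih₁
    obtain ⟨p₂, n₂⟩ := ih₂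
    refine ⟨(n₁.or p₂).congr fun K u => ?_, (p₁.and n₂).congr fun K u => ?_⟩
    · simp only [BoundedFormula.realize_imp]; tauto
    · simp only [BoundedFormula.realize_imp]; tauto

end IsExpTermDefinable

end Definable

/-! ## Part 2: term equations are projections of exponential-polynomial equations (models of `OEF`) -/

section Flatten

variable {κ ι : Type}

/-- The valuation `(ā; x̄, e^{x̄})` of the variables `κ ⊕ (J ⊕ J)` of an exponential polynomial in a
model of `OEF` (as `RealExpModel.env`). [folklore] -/
def env {K : Language.Theory.ModelType.{0, 0, w} Theory.OEF} {J : Type*} (a : κ → K)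
    (x : J → K) : κ ⊕ (J ⊕ J) → K :=
  Sum.elim a (Sum.elim x fun j => exp (x j))

variable {K : Language.Theory.ModelType.{0, 0, w} Theory.OEF}

/-- `env` on a parameter. [folklore] -/
@[simp] theorem env_inl {J : Type*} (a : κ → K) (x : J → K) (c : κ) :
    env a x (Sum.inl c) = a c := rfl

/-- `env` on an unknown. [folklore] -/
@[simp] theorem env_inr_inl {J : Type*} (a : κ → K) (x : J → K) (j : J) :
    env a x (Sum.inr (Sum.inl j)) = x j := rfl

/-- `env` on the exponential of an unknown. [folklore] -/
@[simp] theorem env_inr_inr {J : Type*} (a : κ → K) (x : J → K) (j : J) :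
    env a x (Sum.inr (Sum.inr j)) = exp (x j) := rfl

/-- Relabelling the unknowns commutes with `env`. [folklore] -/
theorem env_comp_map {J J' : Type*} (a : κ → K) (y : J' → K) (g : J → J') :
    env a y ∘ Sum.map _root_.id (Sum.map g g) = env a (y ∘ g) := by
  funext v
  rcases v with c | j | j <;> rfl

/-- The canonical values of the new unknowns at a tuple `ū`: `z_s := s(ā, ū)`. [folklore] -/
def canon (a : κ → K) (u : ι → K) : RealExpModel.FlatIdx κ ι → K :=
  Sum.elim u fun s => s.realize (Sum.elim a u)

/-- At the canonical values, the flattening of `t` takes the value of `t`. [folklore] -/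
theorem realize_flat_canon (a : κ → K) (u : ι → K) (t : Language.orderedExpRing.Term (κ ⊕ ι)) :
    (RealExpModel.flat t).realize (env a (canon a u)) = t.realize (Sum.elim a u) := by
  induction t with
  | var v => rcases v with c | i <;> rfl
  | func f ts ih =>
    cases f with
    | add => simp only [RealExpModel.flat, Language.orderedRing.realize_add, ih, Term.realize, funMap_add]
    | mul => simp only [RealExpModel.flat, Language.orderedRing.realize_mul, ih, Term.realize, funMap_mul]
    | neg => simp only [RealExpModel.flat, Language.orderedRing.realize_neg, ih, Term.realize, funMap_neg]
    | zero => simp only [RealExpModel.flat, Language.orderedRing.realize_zero, Term.realize, funMap_zero]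
    | one => simp only [RealExpModel.flat, Language.orderedRing.realize_one, Term.realize, funMap_one]
    | exp =>
      simp only [RealExpModel.flat, Term.realize, funMap_exp]
      rfl

/-- If values `x` of the unknowns satisfy the constraints of the exponentiated subterms of `t`, the
flattening of `t` takes at `x` the value of `t`. [folklore] -/
theorem realize_flat_of_constraints (a : κ → K) (x : RealExpModel.FlatIdx κ ι → K) :
    ∀ (t : Language.orderedExpRing.Term (κ ⊕ ι)),
      (∀ s ∈ RealExpModel.expArgs t, x (Sum.inr s) = (RealExpModel.flat s).realize (env a x)) →
        (RealExpModel.flat t).realize (env a x) = t.realize (Sum.elim a (x ∘ Sum.inl)) := by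
  intro t
  induction t with
  | var v => intro _; rcases v with c | i <;> rfl
  | func f ts ih =>
    intro hx
    cases f with
    | add =>
      have h0 := ih 0 (fun s hs => hx s (by
        simp only [RealExpModel.expArgs, List.mem_append]; exact Or.inl hs))
      have h1 := ih 1 (fun s hs => hx s (by
        simp only [RealExpModel.expArgs, List.mem_append]; exact Or.inr hs))
      simp only [RealExpModel.flat, Language.orderedRing.realize_add, h0, h1, Term.realize, funMap_add]
    | mul =>
      have h0 := ih 0 (fun s hs => hx s (by
        simp only [RealExpModel.expArgs, List.mem_append]; exact Or.inl hs))
      have h1 := ih 1 (fun s hs => hx s (by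
        simp only [RealExpModel.expArgs, List.mem_append]; exact Or.inr hs))
      simp only [RealExpModel.flat, Language.orderedRing.realize_mul, h0, h1, Term.realize, funMap_mul]
    | neg =>
      have h0 := ih 0 (fun s hs => hx s (by simpa only [RealExpModel.expArgs] using hs))
      simp only [RealExpModel.flat, Language.orderedRing.realize_neg, h0, Term.realize, funMap_neg]
    | zero => simp only [RealExpModel.flat, Language.orderedRing.realize_zero, Term.realize, funMap_zero]
    | one => simp only [RealExpModel.flat, Language.orderedRing.realize_one, Term.realize, funMap_one]
    | exp =>
      have h0 := ih 0 (fun s hs => hx s (by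
        simp only [RealExpModel.expArgs, List.mem_cons]; exact Or.inr hs))
      have hz := hx (ts 0) (by simp [RealExpModel.expArgs])
      simp only [RealExpModel.flat, Term.realize, funMap_exp, env_inr_inr]
      rw [hz, h0]

/-- Semantics of the constraint `cstr s`. [folklore] -/
theorem realize_cstr_eq_zero_iff (a : κ → K) (x : RealExpModel.FlatIdx κ ι → K)
    (s : Language.orderedExpRing.Term (κ ⊕ ι)) :
    (RealExpModel.cstr s).realize (env a x) = 0 ↔
      x (Sum.inr s) = (RealExpModel.flat s).realize (env a x) := by
  simp only [RealExpModel.cstr, Language.orderedRing.realize_add, Language.orderedRing.realize_neg,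
    Term.realize_var, env_inr_inl, ← sub_eq_add_neg, sub_eq_zero]

/-- In a model of `OEF`, `sqAgg l` vanishes iff every member of `l` vanishes. [folklore] -/
theorem realize_sqAgg_eq_zero_iff {α : Type*} (v : α → K) :
    ∀ l : List (Language.orderedRing.Term α),
      (RealExpModel.sqAgg l).realize v = 0 ↔ ∀ e ∈ l, e.realize v = 0
  | [] => by simp [RealExpModel.sqAgg]
  | e :: l => by
    simp only [RealExpModel.sqAgg, Language.orderedRing.realize_add, Language.orderedRing.realize_mul,
      mul_self_add_mul_self_eq_zero, realize_sqAgg_eq_zero_iff v l, List.mem_cons,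
      forall_eq_or_imp]

/-- Semantics of the master equation in a model of `OEF`. [folklore] -/
theorem realize_master_eq_zero_iff (a : κ → K) (x : RealExpModel.FlatIdx κ ι → K)
    (t : Language.orderedExpRing.Term (κ ⊕ ι)) :
    (RealExpModel.master t).realize (env a x) = 0 ↔
      (RealExpModel.flat t).realize (env a x) = 0 ∧
        ∀ s ∈ RealExpModel.expArgs t, x (Sum.inr s) = (RealExpModel.flat s).realize (env a x) := by
  simp only [RealExpModel.master, realize_sqAgg_eq_zero_iff, List.mem_cons, forall_eq_or_imp,
    List.mem_map, forall_exists_index, and_imp, forall_apply_eq_imp_iff₂, realize_cstr_eq_zero_iff]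

/-- A term equation is solvable iff its master (exponential-polynomial) equation is, uniformly in
the models of `OEF`. [folklore] -/
theorem exists_realize_eq_zero_iff_master (a : κ → K) (t : Language.orderedExpRing.Term (κ ⊕ ι)) :
    (∃ u : ι → K, t.realize (Sum.elim a u) = 0) ↔
      ∃ x : RealExpModel.FlatIdx κ ι → K, (RealExpModel.master t).realize (env a x) = 0 := by
  constructor
  · rintro ⟨u, hu⟩
    refine ⟨canon a u, ?_⟩
    rw [realize_master_eq_zero_iff]
    refine ⟨by rw [realize_flat_canon, hu], fun s _ => ?_⟩
    rw [realize_flat_canon]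
    rfl
  · rintro ⟨x, hx⟩
    rw [realize_master_eq_zero_iff] at hx
    refine ⟨x ∘ Sum.inl, ?_⟩
    rw [← realize_flat_of_constraints a x t hx.2, hx.1]

/-- Finite re-indexing of the unknowns, uniformly in the models of `OEF`. [folklore] -/
theorem exists_fin_reindex {J : Type} (P : Language.orderedRing.Term (κ ⊕ (J ⊕ J))) :
    ∃ (N : ℕ) (p : Language.orderedRing.Term (κ ⊕ (Fin N ⊕ Fin N))),
      ∀ (K : Language.Theory.ModelType.{0, 0, w} Theory.OEF) (a : κ → K),
        (∃ x : J → K, P.realize (env a x) = 0) ↔ ∃ y : Fin N → K, p.realize (env a y) = 0 := by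
  classical
  let S : Finset J := (P.varFinset.toRight).toLeft ∪ (P.varFinset.toRight).toRight
  let N : ℕ := Fintype.card S + 1
  let e : S ≃ Fin (Fintype.card S) := Fintype.equivFin S
  let g : J → Fin N := fun j => if h : j ∈ S then Fin.castSucc (e ⟨j, h⟩) else Fin.last _
  refine ⟨N, P.relabel (Sum.map _root_.id (Sum.map g g)), fun K a => ?_⟩
  have hrel : ∀ y : Fin N → K,
      (P.relabel (Sum.map _root_.id (Sum.map g g))).realize (env a y) = P.realize (env a (y ∘ g)) := by
    intro y
    rw [Term.realize_relabel, env_comp_map]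
  constructor
  · rintro ⟨x, hx⟩
    let y : Fin N → K := Fin.lastCases 0 (fun i => x (e.symm i))
    have hy : ∀ j ∈ S, y (g j) = x j := by
      intro j hj
      simp only [y, g, dif_pos hj, Fin.lastCases_castSucc, Equiv.symm_apply_apply]
    refine ⟨y, ?_⟩
    rw [hrel, ← hx]
    refine RealExpModel.realize_eq_of_forall_mem_varFinset P (fun v hv => ?_)
    rcases v with c | j | j
    · rfl
    · have hj : j ∈ S := by
        simp only [S, Finset.mem_union, Finset.mem_toLeft, Finset.mem_toRight]
        exact Or.inl hv
      simp only [env_inr_inl, Function.comp_apply, hy j hj]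
    · have hj : j ∈ S := by
        simp only [S, Finset.mem_union, Finset.mem_toLeft, Finset.mem_toRight]
        exact Or.inr hv
      simp only [env_inr_inr, Function.comp_apply, hy j hj]
  · rintro ⟨y, hy⟩
    exact ⟨y ∘ g, by rw [← hrel, hy]⟩

/-- **Term equations are projections of exponential-polynomial equations, uniformly in the models
of `OEF`.** [folklore] -/
theorem exists_expPoly_iff (t : Language.orderedExpRing.Term (κ ⊕ ι)) :
    ∃ (N : ℕ) (p : Language.orderedRing.Term (κ ⊕ (Fin N ⊕ Fin N))),
      ∀ (K : Language.Theory.ModelType.{0, 0, w} Theory.OEF) (a : κ → K),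
        (∃ u : ι → K, t.realize (Sum.elim a u) = 0) ↔ ∃ y : Fin N → K, p.realize (env a y) = 0 := by
  obtain ⟨N, p, hp⟩ := exists_fin_reindex.{w} (RealExpModel.master t)
  exact ⟨N, p, fun K a => (exists_realize_eq_zero_iff_master a t).trans (hp K a)⟩

end Flatten

/-! ## Existential conditions and sentences -/

/-- **Existential conditions are projections of exponential-polynomial equations, uniformly in the
models of `OEF`**: for every quantifier-free `χ(c̄; v̄)` there are `N`, `p` with
`(∃ v̄, χ(ā; v̄)) ↔ (∃ x̄ ∈ K^N, p(ā; x̄, e^{x̄}) = 0)` in every model `K` of `OEF`. [folklore] -/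
theorem exists_expPoly_iff_of_isQF {κ : Type} {n : ℕ}
    {χ : Language.orderedExpRing.BoundedFormula κ n} (hχ : χ.IsQF) :
    ∃ (N : ℕ) (p : Language.orderedRing.Term (κ ⊕ (Fin N ⊕ Fin N))),
      ∀ (K : Language.Theory.ModelType.{0, 0, w} Theory.OEF) (a : κ → K),
        (∃ xs : Fin n → K, χ.Realize a xs) ↔ ∃ y : Fin N → K, p.realize (env a y) = 0 := by
  obtain ⟨m, t, ht⟩ := (IsExpTermDefinable.of_isQF.{w} hχ).1
  let t' : Language.orderedExpRing.Term (κ ⊕ (Fin n ⊕ Fin m)) :=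
    t.relabel (Equiv.sumAssoc κ (Fin n) (Fin m))
  obtain ⟨N, p, hp⟩ := exists_expPoly_iff.{w} t'
  refine ⟨N, p, fun K a => Iff.trans ?_ (hp K a)⟩
  constructor
  · rintro ⟨xs, hxs⟩
    obtain ⟨w', hw'⟩ := (ht K (Sum.elim a xs)).1 (by simpa using hxs)
    refine ⟨Sum.elim xs w', ?_⟩
    rw [← hw']
    simp only [t', Term.realize_relabel]
    congr 1
    funext v
    rcases v with (c | i) | j <;> rfl
  · rintro ⟨u, hu⟩
    refine ⟨u ∘ Sum.inl, ?_⟩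
    have key := (ht K (Sum.elim a (u ∘ Sum.inl))).2 ⟨u ∘ Sum.inr, ?_⟩
    · simpa using key
    · rw [← hu]
      simp only [t', Term.realize_relabel]
      congr 1
      funext v
      rcases v with (c | i) | j <;> rfl

/-- **Existential formulas, existentially closed, are projections of exponential-polynomial
equations, uniformly in the models of `OEF`**: for `φ(c̄; v̄)` existential (Mathlib's
`BoundedFormula.IsExistential`: a block of `∃` in front of a quantifier-free matrix) there are
`N`, `p` with `(∃ v̄, φ(ā; v̄)) ↔ (∃ x̄ ∈ K^N, p(ā; x̄, e^{x̄}) = 0)` in every model of `OEF`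
(the bound `∃`-block is absorbed into the unknowns). [folklore] -/
theorem exists_expPoly_iff_of_isExistential {κ : Type} {n : ℕ}
    {φ : Language.orderedExpRing.BoundedFormula κ n} (hφ : φ.IsExistential) :
    ∃ (N : ℕ) (p : Language.orderedRing.Term (κ ⊕ (Fin N ⊕ Fin N))),
      ∀ (K : Language.Theory.ModelType.{0, 0, w} Theory.OEF) (a : κ → K),
        (∃ xs : Fin n → K, φ.Realize a xs) ↔ ∃ y : Fin N → K, p.realize (env a y) = 0 := by
  induction hφ with
  | of_isQF hqf => exact exists_expPoly_iff_of_isQF hqf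
  | ex _ ih =>
    obtain ⟨N, p, hp⟩ := ih
    refine ⟨N, p, fun K a => Iff.trans ?_ (hp K a)⟩
    simp only [BoundedFormula.realize_ex]
    constructor
    · rintro ⟨xs, x, hx⟩
      exact ⟨Fin.snoc xs x, hx⟩
    · rintro ⟨xs, hxs⟩
      refine ⟨Fin.init xs, xs (Fin.last _), ?_⟩
      rwa [Fin.snoc_init_self]

/-- **Jones–Servi 2011, Lemma 3.3, for `exp` and the finite theory `OEF`** ("Every existential
sentence is `K`-equivalent to a sentence of the form `∃x̄ g(x̄) = 0`"): for every existential
sentence `φ` of `Language.orderedExpRing` there are `N` and a term `p` of the language of ordered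
rings in `2N` variables (no parameters) such that in every model `K` of `OEF`,
`K ⊨ φ ↔ ∃ x̄ ∈ K^N, p(x̄, e^{x̄}) = 0`.  Via `Theory.ModelType.toOEFModel` this holds in every
model of every `T ⊇ OEF`, and for `ℝ_exp`. [cite: JonesServi2011, Lemma 3.3] -/
theorem realize_iff_expPoly_of_isExistential {φ : Language.orderedExpRing.Sentence}
    (hφ : φ.IsExistential) :
    ∃ (N : ℕ) (p : Language.orderedRing.Term (Empty ⊕ (Fin N ⊕ Fin N))),
      ∀ K : Language.Theory.ModelType.{0, 0, w} Theory.OEF,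
        K ⊨ φ ↔ ∃ y : Fin N → K, p.realize (env (default : Empty → K) y) = 0 := by
  obtain ⟨N, p, hp⟩ := exists_expPoly_iff_of_isExistential.{w} hφ
  refine ⟨N, p, fun K => Iff.trans ?_ (hp K default)⟩
  constructor
  · intro h
    exact ⟨default, h⟩
  · rintro ⟨xs, hxs⟩
    rwa [Subsingleton.elim xs default] at hxs

end OEFModel

end Literature.ModelTheory.ExponentialFields

end
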